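import Mathlib
import HarnessLib
import Literature.Analysis.FluidPDE.VectorCalculus
import Literature.Analysis.FluidPDE.LerayProfileCalculus
import Literature.Analysis.FluidPDE.WholeSpaceIBP
import Literature.Analysis.FluidPDE.HarmonicProbe
import Literature.Analysis.FluidPDE.HarmonicLiouvilleLp
import Literature.Analysis.FluidPDE.TsaiSelfSimilarBounded
import Literature.Analysis.FluidPDE.NSLocalLerayBackwardUniqueness
import Literature.Analysis.FluidPDE.TypeIAncientMildClassical
import Summits.NavierStokesRegularity.NavierStokesRegularity.Theorems.LocalTraceTubeDoorHarmonicOscillation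
import Summits.NavierStokesRegularity.NavierStokesRegularity.Theorems.LocalTraceTubeDoorHarmonicHead
import Summits.NavierStokesRegularity.NavierStokesRegularity.Theorems.LocalHelicityTubeDoorFrobeniusWindowRigidityWindow
import Summits.NavierStokesRegularity.NavierStokesRegularity.Theorems.LocalSineTubeDoorProfileAlignedWindowRigidityAncient
import Summits.NavierStokesRegularity.NavierStokesRegularity.Theorems.PoloidalWindowDoorPoloidalWindowRigidityWindow
import Summits.NavierStokesRegularity.NavierStokesRegularity.Theorems.PoloidalWindowDoorPoloidalWindowRigidityFlat
import Summits.NavierStokesRegularity.NavierStokesRegularity.Theorems.PoloidalWindowDoorPoloidalWindowRigidityPressureOscillation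

/-!
# The one-window door family — the HARMONIC-SPEED profile crux (the `λ = ∞` end of the `Π_λ` family):
# Type-I profiles whose kinetic energy density `|v|²` is HARMONIC on a window of every slice are trivial,
# and the LARGE-SCALE MEAN OF THE PRESSURE WORK `⟪v, ∇p⟫` VANISHES on the class

Cell ns-regularity-ideate, seat p6 (route-directed support for nsreg-p1's door family; bears_on LADDER-NS N0; anchor
`--supports stmt-NavierStokesRegularity-20018`, the profile-rigidity item of the family).  Sequel of the `Π_λ` family
(`…LocalTraceTubeDoorHeadFamily`: `Δ(p + λ|v|²/2) ≡ 0` on windows ⇒ trivial, every real `λ`); the endpoint `Δ|v|² ≡ 0`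
needs a different second step, of independent interest:

* `abs_integral_probeBump_pressureWork_le` — **the large-scale mean of the pressure work vanishes on the class**: for a
  profile of the Type-I class, any window pressure `p`, `s` in the window and `R ≥ 1/2`,
  `|∫ χ_R ⟪v(s), ∇p(s)⟫| ≤ L(C,s)·R⁻¹` (`χ_R` the unit-mass bumps of `HarmonicProbe`): `⟪v,∇p⟫ = div(p v)`, one
  integration by parts against `χ_R` (`integral_inner_gradient_eq_neg_integral_mul_divergence` with `ψ = χ_R v`,
  `div(χ_R v) = ⟪v, ∇χ_R⟫`), the shift `p ↦ p − κ` and the K2 lineage's (F1) `exists_integral_abs_sub_le_class`.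
* `eq_zero_of_harmonic_speed` — **if `⟪v(s), Δv(s)⟫ + |Dv(s)|²_F` (= `½Δ|v(s)|²`) vanishes identically on every slice,
  then `v ≡ 0`**: `|v(s)|²` is bounded harmonic, hence constant in space (`isConst_of_harmonic_bounded`), `= c(s)`;
  the energy balance then reads `c′(s) = −2⟪v,∇p⟫ − 2|Dv|²_F` at EVERY point, so averaging against `χ_R` and letting
  `R → ∞` gives `c′ ≤ 0`; with `0 ≤ c(s) ≤ C²/(−s) → 0` as `s → −∞`, `c ≡ 0`.
* `harmonicSpeedWindowRigidity` — the window form in door-crux shape (slice analyticity).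
WHAT THIS IS NOT: not a claim about Navier–Stokes regularity (Clay A) — a settled stratum / profile crux of a local
regularity CRITERION conditional on local Type I; establishment needs the cross-family referee PASS + reproduction.
-/

noncomputable section

-- the summit and its single sub-problem share the name (CONVENTIONS §1), as in every Theorems file
set_option linter.dupNamespace false

namespace Summit.NavierStokesRegularity.NavierStokesRegularity.Theorems.LocalTraceTubeDoorHarmonicSpeed

open MeasureTheory Set Function Filter Topology TopologicalSpace Metric InnerProductSpace
open scoped RealInnerProductSpace InnerProductSpace Laplacian ContDiff
open Literature.Analysis Literature.Analysis.FluidPDE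
open Summit.NavierStokesRegularity.NavierStokesRegularity.Theorems.LocalTraceTubeDoorHarmonicOscillation
open Summit.NavierStokesRegularity.NavierStokesRegularity.Theorems.LocalTraceTubeDoorHarmonicHead
open Summit.NavierStokesRegularity.NavierStokesRegularity.Theorems.LocalHelicityTubeDoorFrobeniusWindowRigidityWindow
open Summit.NavierStokesRegularity.NavierStokesRegularity.Theorems.LocalSineTubeDoorProfileAlignedWindowRigidityAncient
open Summit.NavierStokesRegularity.NavierStokesRegularity.Theorems.PoloidalWindowDoorPoloidalWindowRigidityWindow
open Summit.NavierStokesRegularity.NavierStokesRegularity.Theorems.PoloidalWindowDoorPoloidalWindowRigidityFlat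
open Summit.NavierStokesRegularity.NavierStokesRegularity.Theorems.PoloidalWindowDoorPoloidalWindowRigidityPressureOscillation

variable {C : ℝ} {v : ℝ → EuclideanSpace ℝ (Fin 3) → EuclideanSpace ℝ (Fin 3)}

/-! ### the large-scale mean of the pressure work vanishes -/

/-- **Pressure work against a bump, after one integration by parts**: for `C¹` fields `w` (divergence-free) and `q`,
and the unit-mass bump `χ_R`, `∫ χ_R ⟪w, ∇q⟫ = −∫ (q − κ) ⟪w, ∇χ_R⟫` for every constant `κ`. -/
theorem integral_probeBump_mul_pressureWork_eq {w : EuclideanSpace ℝ (Fin 3) → EuclideanSpace ℝ (Fin 3)}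
    {q : EuclideanSpace ℝ (Fin 3) → ℝ} (hw : ContDiff ℝ 1 w) (hq : ContDiff ℝ 1 q)
    (hdiv : VectorCalculus.IsDivFree w) {R : ℝ} (hR : 0 < R) (κ : ℝ) :
    ∫ z, probeBump R z * ⟪w z, gradient q z⟫_ℝ = -∫ z, (q z - κ) * ⟪w z, gradient (probeBump R) z⟫_ℝ := by
  have hχ : ContDiff ℝ 1 (probeBump (E := EuclideanSpace ℝ (Fin 3)) R) := contDiff_probeBump R
  have hψ : ContDiff ℝ 1 fun z => probeBump R z • w z := hχ.smul hw
  have hψc : HasCompactSupport fun z => probeBump R z • w z := (hasCompactSupport_probeBump hR).smul_right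
  have hq' : ContDiff ℝ 1 fun z => q z - κ := hq.sub contDiff_const
  have h := integral_inner_gradient_eq_neg_integral_mul_divergence hq' hψ hψc
  have hgrad : ∀ z, gradient (fun z => q z - κ) z = gradient q z := fun z => by
    rw [gradient, gradient, fderiv_sub_const]
  have hdivψ : ∀ z, VectorCalculus.divergence (fun y => probeBump R y • w y) z = ⟪w z, gradient (probeBump R) z⟫_ℝ := by
    intro z
    rw [divergence_smul_apply ((hχ.differentiable one_ne_zero) z) ((hw.differentiable one_ne_zero) z), hdiv z,
      mul_zero, zero_add]
  have hl : ∫ z, ⟪gradient (fun z => q z - κ) z, probeBump R z • w z⟫_ℝ = ∫ z, probeBump R z * ⟪w z, gradient q z⟫_ℝ := by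
    refine integral_congr_ae (Eventually.of_forall fun z => ?_)
    show ⟪gradient (fun z => q z - κ) z, probeBump R z • w z⟫_ℝ = probeBump R z * ⟪w z, gradient q z⟫_ℝ
    rw [hgrad z, real_inner_smul_right, real_inner_comm]
  have hr : ∫ z, (q z - κ) * VectorCalculus.divergence (fun y => probeBump R y • w y) z =
      ∫ z, (q z - κ) * ⟪w z, gradient (probeBump R) z⟫_ℝ := by
    refine integral_congr_ae (Eventually.of_forall fun z => ?_)
    show (q z - κ) * VectorCalculus.divergence (fun y => probeBump R y • w y) z = (q z - κ) * ⟪w z, gradient (probeBump R) z⟫_ℝ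
    rw [hdivψ z]
  rw [← hl, h, hr]

/-- **THE LARGE-SCALE MEAN OF THE PRESSURE WORK VANISHES ON THE CLASS**: for a profile of the Type-I class (rate `C`,
Oseen–Duhamel identity), a pressure `p` making it classical on a window `(t₀, 0) ∋ s` and `R ≥ 1/2`,
`|∫ χ_R(z) ⟪v(s,z), ∇p(s,z)⟫ dz| ≤ (m⁻¹ C_θ · 2³|B̄₁| · K) · (C/√(−s)) · (C²/(−s)) · R⁻¹`. -/
theorem abs_integral_probeBump_pressureWork_le (hrate : HasTypeITimeDecay C v)
    (hmild : ∀ s t : ℝ, s < t → t < 0 → ∀ x,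
      v t x = UnboundedOperators.heatExtension (v s) (t - s) x - oseenDuhamel 1 s v v t x)
    (hdiv : ∀ t < 0, VectorCalculus.IsDivFree (v t)) :
    ∃ L : ℝ, 0 ≤ L ∧ ∀ {t₀ : ℝ}, t₀ < 0 → ∀ {p : ℝ → EuclideanSpace ℝ (Fin 3) → ℝ},
      IsClassicalNSSolutionOn (Ioo t₀ 0) 1 0 v p → ∀ {s : ℝ}, s ∈ Ioo t₀ 0 → ∀ {R : ℝ}, 1 / 2 ≤ R →
      |∫ z, probeBump R z * ⟪v s z, gradient (p s) z⟫_ℝ| ≤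
        L * (C / Real.sqrt (-s)) * (C ^ 2 / (-s)) * R⁻¹ := by
  obtain ⟨Cθ, hCθ⟩ := (exists_bound_baseBump_derivs (E := EuclideanSpace ℝ (Fin 3))).1
  obtain ⟨K, hK0, hF1⟩ := exists_integral_abs_sub_le_class
  set m := baseBumpMass (EuclideanSpace ℝ (Fin 3)) with hm
  have hm0 : 0 < m := baseBumpMass_pos
  have hC0' : 0 ≤ Cθ := (norm_nonneg _).trans (hCθ 0)
  set vb : ℝ := (volume (closedBall (0 : EuclideanSpace ℝ (Fin 3)) 1)).toReal with hvb
  have hvb0 : 0 ≤ vb := ENNReal.toReal_nonneg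
  refine ⟨m⁻¹ * Cθ * (2 : ℝ) ^ 3 * vb * K, by positivity, ?_⟩
  intro t₀ ht₀ p hcl s hs R hR
  have hR0 : 0 < R := by linarith
  have hs0 : 0 < -s := by linarith [hs.2]
  have hC0 : 0 ≤ C := by
    have h := hrate (-1) (by norm_num) 0
    rw [neg_neg, Real.sqrt_one, div_one] at h
    exact (norm_nonneg _).trans h
  have hv1 : ContDiff ℝ 1 (v s) := contDiff_infty.1 (hcl.contDiff_velocity hs) 1
  have hp1 : ContDiff ℝ 1 (p s) := contDiff_infty.1 (hcl.contDiff_pressure hs) 1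
  -- (F1) on the ball `B̄(0, 2R)`, `2R ≥ 1`
  obtain ⟨κ, hκ⟩ := hF1 hrate hmild ht₀ hcl s hs 0 (2 * R) (by linarith)
  rw [integral_probeBump_mul_pressureWork_eq hv1 hp1 (hdiv s hs.2) hR0 κ, abs_neg]
  -- the bound on `⟪v, ∇χ_R⟫`, supported in `B̄(0, 2R)`
  set c := (m * R ^ 3)⁻¹ * R⁻¹ * Cθ with hc
  have hc0 : 0 ≤ c := by positivity
  have hrateS : ∀ z, ‖v s z‖ ≤ C / Real.sqrt (-s) := fun z => hrate s hs.2 z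
  have hd : Module.finrank ℝ (EuclideanSpace ℝ (Fin 3)) = 3 := finrank_euclideanSpace_fin
  have hgr : ∀ z, ⟪v s z, gradient (probeBump R) z⟫_ℝ = fderiv ℝ (probeBump R) z (v s z) := fun z => by
    rw [real_inner_comm]
    exact InnerProductSpace.toDual_symm_apply
  have hDχ : ∀ z, |⟪v s z, gradient (probeBump R) z⟫_ℝ| ≤ C / Real.sqrt (-s) * c := fun z => by
    rw [hgr z, ← Real.norm_eq_abs]
    have h := norm_fderiv_probeBump_le hR0 hCθ z
    rw [← hm, hd] at h
    calc ‖fderiv ℝ (probeBump R) z (v s z)‖ ≤ ‖fderiv ℝ (probeBump R) z‖ * ‖v s z‖ :=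
          ContinuousLinearMap.le_opNorm _ _
      _ ≤ c * (C / Real.sqrt (-s)) := mul_le_mul h (hrateS z) (norm_nonneg _) hc0
      _ = C / Real.sqrt (-s) * c := mul_comm _ _
  set g : EuclideanSpace ℝ (Fin 3) → ℝ := fun z =>
    (closedBall (0 : EuclideanSpace ℝ (Fin 3)) (2 * R)).indicator (fun z => c * (C / Real.sqrt (-s)) * |p s z - κ|) z
    with hg
  have hdom : ∀ z, ‖(p s z - κ) * ⟪v s z, gradient (probeBump R) z⟫_ℝ‖ ≤ g z := by
    intro z
    simp only [hg]
    by_cases hz : z ∈ closedBall (0 : EuclideanSpace ℝ (Fin 3)) (2 * R)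
    · rw [indicator_of_mem hz, norm_mul, Real.norm_eq_abs, Real.norm_eq_abs]
      calc |p s z - κ| * |⟪v s z, gradient (probeBump R) z⟫_ℝ| ≤ |p s z - κ| * (C / Real.sqrt (-s) * c) :=
            mul_le_mul_of_nonneg_left (hDχ z) (abs_nonneg _)
        _ = c * (C / Real.sqrt (-s)) * |p s z - κ| := by ring
    · rw [indicator_of_notMem hz]
      have hz' : z ∉ tsupport (probeBump (E := EuclideanSpace ℝ (Fin 3)) R) :=
        fun h => hz (tsupport_probeBump_subset hR0 h)
      rw [hgr z, fderiv_of_notMem_tsupport ℝ hz']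
      simp
  have hpc : Continuous fun z => |p s z - κ| := ((hp1.continuous).sub continuous_const).abs
  have hgi : Integrable g := by
    rw [hg, integrable_indicator_iff measurableSet_closedBall]
    exact (continuous_const.mul hpc).continuousOn.integrableOn_compact (isCompact_closedBall _ _)
  have hint := norm_integral_le_of_norm_le hgi (Eventually.of_forall hdom)
  rw [Real.norm_eq_abs] at hint
  refine hint.trans ?_
  rw [hg, integral_indicator measurableSet_closedBall, integral_const_mul]
  have hvol : volume.real (closedBall (0 : EuclideanSpace ℝ (Fin 3)) (2 * R)) = (2 : ℝ) ^ 3 * R ^ 3 * vb := by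
    rw [Measure.addHaar_real_closedBall' volume 0 (by positivity : (0 : ℝ) ≤ 2 * R), hd, mul_pow, hvb,
      measureReal_def]
  have h2 : ∫ z in closedBall (0 : EuclideanSpace ℝ (Fin 3)) (2 * R), |p s z - κ| ≤
      K * (C ^ 2 / (-s)) * ((2 : ℝ) ^ 3 * R ^ 3 * vb) := by rw [← hvol]; exact hκ
  have hpre : 0 ≤ c * (C / Real.sqrt (-s)) := mul_nonneg hc0 (div_nonneg hC0 (Real.sqrt_nonneg _))
  refine (mul_le_mul_of_nonneg_left h2 hpre).trans_eq ?_
  have hR3 : R ^ 3 ≠ 0 := pow_ne_zero _ hR0.ne'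
  rw [hc]
  field_simp

/-! ### the class: profiles with harmonic kinetic energy density -/

/-- **TYPE-I PROFILES WITH HARMONIC `|v|²` ARE TRIVIAL**: if `⟪v(s,y), Δv(s)(y)⟫ + |Dv(s)(y)|²_F = 0` (that is,
`Δ|v(s)|² = 0`) at every point of every slice `s < 0`, then `v ≡ 0`.  See the module docstring for the proof. -/
theorem eq_zero_of_harmonic_speed (hrate : HasTypeITimeDecay C v)
    (hcont : ContinuousOn (uncurry v) (Iio (0 : ℝ) ×ˢ univ))
    (hmild : ∀ s t : ℝ, s < t → t < 0 → ∀ x,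
      v t x = UnboundedOperators.heatExtension (v s) (t - s) x - oseenDuhamel 1 s v v t x)
    (hdiv : ∀ t < 0, VectorCalculus.IsDivFree (v t))
    (hH : ∀ s < 0, ∀ y : EuclideanSpace ℝ (Fin 3), ⟪v s y, (Δ (v s)) y⟫_ℝ + frobeniusNormSq (fderiv ℝ (v s) y) = 0) :
    ∀ t < 0, ∀ x, v t x = 0 := by
  have hA : IsTypeIAncientMild C v := isTypeIAncientMild_of_class hrate hcont hmild hdiv
  have hsm : IsSmoothSpaceTimeOn (Iio 0) v := hA.contDiffOn
  have hC0 : 0 ≤ C := by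
    have h := hrate (-1) (by norm_num) 0
    rw [neg_neg, Real.sqrt_one, div_one] at h
    exact (norm_nonneg _).trans h
  obtain ⟨L, hL0, hL⟩ := abs_integral_probeBump_pressureWork_le hrate hmild hdiv
  -- the energy density, harmonic and bounded on every slice, is constant in space
  set q : ℝ → EuclideanSpace ℝ (Fin 3) → ℝ := fun τ y => ⟪v τ y, v τ y⟫_ℝ with hqdef
  have hqbd : ∀ s < 0, ∀ y, q s y ≤ C ^ 2 / (-s) := fun s hs y => by
    simp only [hqdef, real_inner_self_eq_norm_sq]
    have h1 := hrate s hs y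
    have h2 : ‖v s y‖ ^ 2 ≤ (C / Real.sqrt (-s)) ^ 2 := pow_le_pow_left₀ (norm_nonneg _) h1 2
    rwa [div_pow, Real.sq_sqrt (neg_pos.2 hs).le] at h2
  have hq0 : ∀ s y, 0 ≤ q s y := fun s y => real_inner_self_nonneg
  have hconst : ∀ s < 0, ∀ y, q s y = q s 0 := by
    intro s hs y
    have hv2 : ContDiff ℝ 2 (v s) :=
      (analyticOnNhd_slice hcont (bdd_of_hasTypeITimeDecay hrate) hmild hs).contDiff
    have hq2 : ContDiff ℝ 2 (q s) := hv2.inner ℝ hv2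
    have hharm : HarmonicOnNhd (q s) univ := by
      refine harmonicOnNhd_of_laplacian_eq_zero hq2 fun x => ?_
      have hL' : (Δ (q s)) x = 2 * ⟪(Δ (v s)) x, v s x⟫_ℝ + 2 * frobeniusNormSq (fderiv ℝ (v s) x) :=
        laplacian_inner_self_eq hv2 x
      rw [hL', real_inner_comm]
      linarith [hH s hs x]
    exact isConst_of_harmonic_bounded hharm ⟨C ^ 2 / (-s), fun x => by
      rw [abs_of_nonneg (hq0 s x)]; exact hqbd s hs x⟩ y 0
  set c : ℝ → ℝ := fun τ => q τ 0 with hcdef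
  -- at every `s < 0` and every `y`: `c′(s) = −2⟪v,∇p⟫(s,y) − 2|Dv(s,y)|²`
  have hderiv : ∀ s < 0, ∀ {t₀ : ℝ} (_ : t₀ < s) {p : ℝ → EuclideanSpace ℝ (Fin 3) → ℝ},
      IsClassicalNSSolutionOn (Ioo t₀ 0) 1 0 v p → ∀ y,
      HasDerivAt c (-2 * ⟪v s y, gradient (p s) y⟫_ℝ - 2 * frobeniusNormSq (fderiv ℝ (v s) y)) s := by
    intro s hs t₀ ht₀ p hcl y
    have hsI : s ∈ Ioo t₀ 0 := ⟨ht₀, hs⟩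
    have hbal := energyDensity_balance isOpen_Ioo hcl hsI y
    -- `∇q(s) = 0`, `Δq(s) = 0`
    have hv2 : ContDiff ℝ 2 (v s) := contDiff_infty.1 (hcl.contDiff_velocity hsI) 2
    have hfun : q s = fun _ => q s 0 := funext fun z => hconst s hs z
    have hX : fderiv ℝ (fun z => ⟪v s z, v s z⟫_ℝ) y (v s y) = 0 := by
      rw [show (fun z => ⟪v s z, v s z⟫_ℝ) = q s from rfl, hfun]
      simp
    have hLap : (Δ (fun z => ⟪v s z, v s z⟫_ℝ)) y = 0 := by
      have hL' : (Δ (q s)) y = 2 * ⟪(Δ (v s)) y, v s y⟫_ℝ + 2 * frobeniusNormSq (fderiv ℝ (v s) y) :=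
        laplacian_inner_self_eq hv2 y
      rw [show (fun z => ⟪v s z, v s z⟫_ℝ) = q s from rfl, hL', real_inner_comm]
      linarith [hH s hs y]
    rw [hX, hLap, mul_zero, add_zero, sub_zero] at hbal
    have hdu : HasDerivWithinAt (fun τ => v τ y) (timeDerivWithin (Ioo t₀ 0) v s y) (Ioo t₀ 0) s := by
      rw [timeDerivWithin_apply]
      exact (hcl.smooth_velocity.differentiableWithinAt_time hsI y).hasDerivWithinAt
    have hqy : HasDerivAt (fun τ => ⟪v τ y, v τ y⟫_ℝ)
        (⟪v s y, timeDerivWithin (Ioo t₀ 0) v s y⟫_ℝ + ⟪timeDerivWithin (Ioo t₀ 0) v s y, v s y⟫_ℝ) s :=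
      (hdu.inner ℝ hdu).hasDerivAt (isOpen_Ioo.mem_nhds hsI)
    have hT : timeDerivWithin (Ioo t₀ 0) (fun τ z => ⟪v τ z, v τ z⟫_ℝ) s y =
        ⟪v s y, timeDerivWithin (Ioo t₀ 0) v s y⟫_ℝ + ⟪timeDerivWithin (Ioo t₀ 0) v s y, v s y⟫_ℝ := by
      rw [timeDerivWithin_apply, derivWithin_of_isOpen isOpen_Ioo hsI, hqy.deriv]
    rw [hT] at hbal
    have hev : (fun τ => ⟪v τ y, v τ y⟫_ℝ) =ᶠ[𝓝 s] c := by
      filter_upwards [isOpen_Iio.mem_nhds hs] with τ hτ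
      exact hconst τ hτ y
    have hc' := hqy.congr_of_eventuallyEq hev.symm
    have e : ⟪v s y, timeDerivWithin (Ioo t₀ 0) v s y⟫_ℝ + ⟪timeDerivWithin (Ioo t₀ 0) v s y, v s y⟫_ℝ =
        -2 * ⟪v s y, gradient (p s) y⟫_ℝ - 2 * frobeniusNormSq (fderiv ℝ (v s) y) := by linarith
    rw [e] at hc'
    exact hc'
  have hc'le : ∀ s < 0, deriv c s ≤ 0 := by
    intro s hs
    have ht₀ : s - 1 < 0 := by linarith
    obtain ⟨p, hcl⟩ := hA.exists_isClassicalNSSolutionOn_Ioo ht₀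
    have hsI : s ∈ Ioo (s - 1) 0 := ⟨by linarith, hs⟩
    have hs0 : 0 < -s := neg_pos.2 hs
    have hD : ∀ y, HasDerivAt c (-2 * ⟪v s y, gradient (p s) y⟫_ℝ - 2 * frobeniusNormSq (fderiv ℝ (v s) y)) s :=
      fun y => hderiv s hs (by linarith) hcl y
    have hval : ∀ y, deriv c s = -2 * ⟪v s y, gradient (p s) y⟫_ℝ - 2 * frobeniusNormSq (fderiv ℝ (v s) y) :=
      fun y => (hD y).deriv
    -- for every `R ≥ 1/2`: `deriv c s ≤ 2 L' R⁻¹`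
    set L' : ℝ := L * (C / Real.sqrt (-s)) * (C ^ 2 / (-s)) with hL'
    have hkey : ∀ R : ℝ, 1 / 2 ≤ R → deriv c s ≤ 2 * L' * R⁻¹ := by
      intro R hR
      have hR0 : 0 < R := by linarith
      have hv1 : ContDiff ℝ 1 (v s) := contDiff_infty.1 (hcl.contDiff_velocity hsI) 1
      have hp1 : ContDiff ℝ 1 (p s) := contDiff_infty.1 (hcl.contDiff_pressure hsI) 1
      have hχc : Continuous (probeBump (E := EuclideanSpace ℝ (Fin 3)) R) := (contDiff_probeBump R (n := 0)).continuous
      have hχs : HasCompactSupport (probeBump (E := EuclideanSpace ℝ (Fin 3)) R) := hasCompactSupport_probeBump hR0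
      have hPWc : Continuous fun z => ⟪v s z, gradient (p s) z⟫_ℝ :=
        hv1.continuous.inner (continuous_gradient_of_contDiff hp1)
      have hFc : Continuous fun z => frobeniusNormSq (fderiv ℝ (v s) z) :=
        continuous_frobeniusNormSq_fderiv hv1 one_ne_zero
      have hI1 : Integrable fun z => probeBump R z * ⟪v s z, gradient (p s) z⟫_ℝ :=
        (hχc.mul hPWc).integrable_of_hasCompactSupport hχs.mul_right
      have hI2 : Integrable fun z => probeBump R z * frobeniusNormSq (fderiv ℝ (v s) z) :=
        (hχc.mul hFc).integrable_of_hasCompactSupport hχs.mul_right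
      have hrepr : deriv c s = -2 * (∫ z, probeBump R z * ⟪v s z, gradient (p s) z⟫_ℝ) -
          2 * ∫ z, probeBump R z * frobeniusNormSq (fderiv ℝ (v s) z) := by
        have h1 : ∫ z : EuclideanSpace ℝ (Fin 3), probeBump R z * deriv c s = deriv c s := by
          rw [integral_mul_const, integral_probeBump hR0, one_mul]
        rw [← h1]
        have h2 : (fun z : EuclideanSpace ℝ (Fin 3) => probeBump R z * deriv c s) = fun z =>
            -2 * (probeBump R z * ⟪v s z, gradient (p s) z⟫_ℝ) - 2 * (probeBump R z * frobeniusNormSq (fderiv ℝ (v s) z)) := by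
          funext z; rw [hval z]; ring
        rw [h2, integral_sub (hI1.const_mul _) (hI2.const_mul _), integral_const_mul, integral_const_mul]
      have hnn : 0 ≤ ∫ z, probeBump R z * frobeniusNormSq (fderiv ℝ (v s) z) :=
        integral_nonneg fun z => mul_nonneg (probeBump_nonneg hR0 z) (frobeniusNormSq_nonneg _)
      have hpw := hL ht₀ hcl hsI hR
      rw [← hL'] at hpw
      rw [hrepr]
      have habs := (abs_le.1 hpw)
      linarith [habs.1, habs.2, hnn]
    have hL'0 : 0 ≤ L' := by rw [hL']; positivity
    refine le_of_forall_pos_le_add fun η hη => ?_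
    set R : ℝ := max (1 / 2) (2 * L' / η) with hR
    have hR1 : 1 / 2 ≤ R := le_max_left _ _
    have hR0 : 0 < R := by linarith
    have h1 := hkey R hR1
    have h2 : 2 * L' * R⁻¹ ≤ η := by
      rw [← div_eq_mul_inv, div_le_iff₀ hR0]
      have : 2 * L' / η ≤ R := le_max_right _ _
      rw [div_le_iff₀ hη] at this
      linarith [mul_comm R η]
    linarith
  -- `c` is antitone on `(−∞, 0)`
  have hcdiff : ∀ s < 0, DifferentiableAt ℝ c s := by
    intro s hs
    obtain ⟨p, hcl⟩ := hA.exists_isClassicalNSSolutionOn_Ioo (by linarith : s - 1 < 0)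
    exact (hderiv s hs (by linarith) hcl 0).differentiableAt
  have hanti : AntitoneOn c (Iio 0) := by
    refine antitoneOn_of_deriv_nonpos (convex_Iio 0) ?_ ?_ ?_
    · exact fun s hs => (hcdiff s hs).continuousAt.continuousWithinAt
    · rw [interior_Iio]; exact fun s hs => (hcdiff s hs).differentiableWithinAt
    · rw [interior_Iio]; exact fun s hs => hc'le s hs
  intro t ht x
  have hct : c t ≤ 0 := by
    refine le_of_forall_pos_le_add fun η hη => ?_
    -- `s₀ = min (t − 1) (−C²/η)` has `c s₀ ≤ C²/(−s₀) ≤ η` and `s₀ ≤ t`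
    set s₀ : ℝ := t - 1 - C ^ 2 / η with hs₀
    have hq' : 0 ≤ C ^ 2 / η := div_nonneg (sq_nonneg C) hη.le
    have hs₀t : s₀ ≤ t := by rw [hs₀]; linarith
    have hs₀0 : s₀ < 0 := by linarith
    have hpos : 0 < -s₀ := by linarith
    have hns₀ : C ^ 2 / η ≤ -s₀ := by rw [hs₀]; linarith
    have h1 : c t ≤ c s₀ := hanti hs₀0 ht hs₀t
    have h2 : c s₀ ≤ C ^ 2 / (-s₀) := hqbd s₀ hs₀0 0
    have h3 : C ^ 2 / (-s₀) ≤ η := by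
      rw [div_le_iff₀ hpos]
      calc C ^ 2 = C ^ 2 / η * η := by field_simp
        _ ≤ -s₀ * η := mul_le_mul_of_nonneg_right hns₀ hη.le
        _ = η * -s₀ := mul_comm _ _
    linarith
  have hqt : q t x = 0 := le_antisymm ((hconst t ht x).trans_le hct) (hq0 t x)
  simpa only [hqdef, inner_self_eq_zero] using hqt

/-- **The harmonic-speed stratum is settled**: such a profile is not backward-singular. -/
theorem not_backwardSingular_of_harmonic_speed (hrate : HasTypeITimeDecay C v)
    (hcont : ContinuousOn (uncurry v) (Iio (0 : ℝ) ×ˢ univ))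
    (hmild : ∀ s t : ℝ, s < t → t < 0 → ∀ x,
      v t x = UnboundedOperators.heatExtension (v s) (t - s) x - oseenDuhamel 1 s v v t x)
    (hdiv : ∀ t < 0, VectorCalculus.IsDivFree (v t))
    (hH : ∀ s < 0, ∀ y : EuclideanSpace ℝ (Fin 3), ⟪v s y, (Δ (v s)) y⟫_ℝ + frobeniusNormSq (fderiv ℝ (v s) y) = 0) :
    ¬ IsBackwardSingularPoint v 0 :=
  not_backwardSingular_of_zero (eq_zero_of_harmonic_speed hrate hcont hmild hdiv hH)

/-! ### window → slab -/

/-- **`y ↦ |Dw(y)|²_F` is real-analytic for a real-analytic field.** -/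
theorem analyticOnNhd_frobeniusNormSq_fderiv {w : EuclideanSpace ℝ (Fin 3) → EuclideanSpace ℝ (Fin 3)}
    (hw : AnalyticOnNhd ℝ w univ) : AnalyticOnNhd ℝ (fun y => frobeniusNormSq (fderiv ℝ w y)) univ := by
  have hD : AnalyticOnNhd ℝ (fderiv ℝ w) univ := hw.fderiv
  have hterm : ∀ i, AnalyticOnNhd ℝ (fun y => fderiv ℝ w y ((stdOrthonormalBasis ℝ (EuclideanSpace ℝ (Fin 3))) i)) univ :=
    fun i y hy => ((ContinuousLinearMap.apply ℝ (EuclideanSpace ℝ (Fin 3))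
      ((stdOrthonormalBasis ℝ (EuclideanSpace ℝ (Fin 3))) i)).analyticAt _).comp (hD y hy)
  have hsq : ∀ i, AnalyticOnNhd ℝ (fun y => ‖fderiv ℝ w y ((stdOrthonormalBasis ℝ (EuclideanSpace ℝ (Fin 3))) i)‖ ^ 2) univ :=
    fun i => AnalyticOnNhd.congr isOpen_univ (analyticOnNhd_inner (hterm i) (hterm i))
      fun y _ => real_inner_self_eq_norm_sq _
  have h := Finset.analyticOnNhd_sum Finset.univ fun i _ => hsq i
  refine AnalyticOnNhd.congr isOpen_univ h fun y _ => ?_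
  simp only [Finset.sum_apply]
  rfl

/-- **The speed source `y ↦ ⟪v(s,y), Δv(s)(y)⟫ + |Dv(s)(y)|²_F` of a slice of a profile of the class is real-analytic.** -/
theorem analyticOnNhd_speedSource_slice (hrate : HasTypeITimeDecay C v)
    (hcont : ContinuousOn (uncurry v) (Iio (0 : ℝ) ×ˢ univ))
    (hmild : ∀ s t : ℝ, s < t → t < 0 → ∀ x,
      v t x = UnboundedOperators.heatExtension (v s) (t - s) x - oseenDuhamel 1 s v v t x)
    {s : ℝ} (hs : s < 0) :
    AnalyticOnNhd ℝ (fun y => ⟪v s y, (Δ (v s)) y⟫_ℝ + frobeniusNormSq (fderiv ℝ (v s) y)) univ := by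
  have hslice := analyticOnNhd_slice hcont (bdd_of_hasTypeITimeDecay hrate) hmild hs
  exact (analyticOnNhd_inner hslice (analyticOnNhd_laplacian hslice)).add (analyticOnNhd_frobeniusNormSq_fderiv hslice)

/-- **THE PROFILE WINDOW CRUX OF THE HARMONIC-SPEED DOOR, PROVED**: a profile of the family's Type-I class on which
`⟪v(s), Δv(s)⟫ + |Dv(s)|²_F` (half the Laplacian of the kinetic energy density) vanishes on a nonempty open window of
every slice `s < 0` is not backward-singular at the apex. -/
theorem harmonicSpeedWindowRigidity :
    ∀ (C : ℝ) (v : ℝ → EuclideanSpace ℝ (Fin 3) → EuclideanSpace ℝ (Fin 3)),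
      Literature.Analysis.FluidPDE.HasTypeITimeDecay C v →
      ContinuousOn (Function.uncurry v) (Set.Iio (0 : ℝ) ×ˢ Set.univ) →
      (∀ s t : ℝ, s < t → t < 0 → ∀ x, v t x =
        Literature.Analysis.UnboundedOperators.heatExtension (v s) (t - s) x -
          Literature.Analysis.FluidPDE.oseenDuhamel 1 s v v t x) →
      (∀ t < 0, Literature.Analysis.FluidPDE.VectorCalculus.IsDivFree (v t)) →
      (∀ s < 0, ∃ U : Set (EuclideanSpace ℝ (Fin 3)), IsOpen U ∧ U.Nonempty ∧
        ∀ y ∈ U, ⟪v s y, (Δ (v s)) y⟫_ℝ +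
          Literature.Analysis.FluidPDE.frobeniusNormSq (fderiv ℝ (v s) y) = 0) →
      ¬ Literature.Analysis.FluidPDE.IsBackwardSingularPoint v 0 := by
  intro C v hrate hcont hmild hdiv hwin
  refine not_backwardSingular_of_harmonic_speed hrate hcont hmild hdiv fun s hs => ?_
  obtain ⟨U, hU, hne, hal⟩ := hwin s hs
  exact real_eq_zero_spread (analyticOnNhd_speedSource_slice hrate hcont hmild hs) hU hne hal

end Summit.NavierStokesRegularity.NavierStokesRegularity.Theorems.LocalTraceTubeDoorHarmonicSpeed

end
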